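import Summits.BirchSwinnertonDyer.BirchSwinnertonDyer.Theorems.ClassRecordThreeExceptionalZeroRoadTightness
import Summits.BirchSwinnertonDyer.Rank1Residual.X11b.ClassClosureWeightKChainLever
import HarnessLib

/-!
# Route `ClassRecordThree` ∕ class X11b: the exceptional-zero road READ BACKWARDS (I) — in analytic
# rank ONE at a multiplicative prime, the lower half of `BSD(E,p)` + the `p`-adic Gross–Zagier display
# at the pair + the pair's Schneider certificate IMPLY Mazur's main conjecture at the pair: Kato's
# divisibility is an equality (cell `bsd-stepL`, seat `mult-p4` g1; file 1 of 2)

Cell `bsd-stepL` (D-0131 (3) middle tier, seat `bsd-stepL-mult-p4`, strategy «split-multiplicative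
`r = 1` via the 𝓛-invariant `p`-adic Gross–Zagier + Kobayashi 2006 ⇒ B10»). THEOREMS ONLY: no
definition, no named fact, no `sorry`; every theorem is CONDITIONAL on the PUBLISHED named facts in
its binders — Kato's divisibility for surjective `ρ_{E,p^∞}` at `p ∥ N` (`hKato`,
`Wuthrich2014.kato_charIdeal_dvd_multiplicative_of_surjective`), Stein–Wuthrich 2013 Thm. 6.1
split ∕ non-split (`hJs` ∕ `hJn`) with the §4.2 heights (`hHs` ∕ `hHn`), Gross–Zagier I.(7.3)
(`hGZ`), GZK (`hGZK`) — on the `p`-adic Gross–Zagier display AT THE PAIR (non-split: Disegni 2020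
Thm. 4 first bullet, any odd `p`, PUBLISHED, inline binder `hD`; split: the EVIDENCE-labelled
conjecture `ClassClosure.RelativeExceptionalLeadingTermAt W p`, `hC`), on the pair's Schneider
certificate and on its image certificate `ρ̄_{E,p^n}` onto. Nothing is booked; X11b stays
CONSTRUCTION-SHAPED.

## What is proved (gen 1 = the converse ∕ IMC leg; gen 0 = `…ExceptionalZeroRoadTightness.lean`)

The tree reads Mazur's main conjecture at a multiplicative pair, `X2.MazurMainConjectureAt W p`
(`X2/Cells.lean`: `X(E/ℚ_∞)` torsion, `char = (g)`, `ι(T^e·g·w) = ϖ·L_p`, `w ∈ Λˣ` — verbatim the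
conclusion of Skinner 2016 Thm. A, printed under (irr)+(ram)), FORWARD into `BSD(E,p)` in analytic
rank one through the lever (`ClassClosure.bsdp_of_mazurMainConjectureAt_of_nonsplit_of_schneider`,
`…_of_split_of_conjecture_of_schneider`; cc-typer-3). In analytic rank ZERO x11a gen 13 proved the
CONVERSE (`X11a.mazurMainConjectureAt_of_bsdp`: Greenberg–Stevens + Kato + Jones). This file is the
analytic-rank-ONE converse, whose analytic input is exactly the exceptional-zero road's object:

1. `isUnit_of_cofactor_identity` (valuation algebra): `h(0)·u·#S·M = u'·s·M` in `ℚ_p` with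
   `M ≠ 0`, units `u, u'`, `#S ≥ 1`, `s ∈ ℚ^×`, `ord_p s ≤ ord_p #S` forces `h ∈ Λˣ`.
2. `isUnit_cofactor_of_relativeLeadingTerm_split` ∕ `…_nonsplit` (datum level): Kato's shape
   `ι(T^e·g·h) = c·L` with an ARBITRARY cofactor `h ∈ Λ`, Jones's clauses for the generator `g`
   (SW Thm. 6.1), the relative display at the pair, `Reg_p(Dh) ≠ 0` and `ord_p s ≤ ord_p #Ш[p^∞]`
   ⟹ `h` is a unit.
3. `mazurMainConjectureAt_of_missingLowerBoundAt_of_split` ∕ `…_of_nonsplit`: at a multiplicative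
   odd `p` with `ρ̄_{E,p^n}` onto for all `n` and `r_an = 1`: `Typed.MissingLowerBoundAt W p` +
   [conjecture (split) | Disegni non-split clause at the pair] + Schneider for THE §4.2 datum ⟹
   `X2.MazurMainConjectureAt W p`. No (ram), no `μ`, no second multiplicative prime, no `p ≥ 5`.
File 2 (`…ExceptionalZeroRoadTriangle.lean`): the `BSDp` forms, the equivalences with the tree's
forward lever theorems, the (ram)-free tightness and the «exceptional-zero triangle».

NOT here: `p = 2`; any class-wide closure; any new fact; the non-surjective image. References:
[Wuthrich2014] Thm. 3, Cor. 19; [SteinWuthrich2013] Thm. 6.1, §4.2; [Disegni2020] Thm. 4 (§3.2);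
[Skinner2016PacificMC] Thm. A (shape); [GreenbergLNM1716] §4–5 (the rank-0 argument);
[GrossZagier1986] I.(7.3); [MazurTateTeitelbaum1986Invent] §II.10; [Miller2011LMS] Def. 1.1.
-/

set_option autoImplicit false

-- Theorems files of this problem live in `Summit.BirchSwinnertonDyer.BirchSwinnertonDyer.Theorems.*`.
set_option linter.dupNamespace false

noncomputable section

open scoped Classical MatrixGroups ModularForm

open CongruenceSubgroup WeierstrassCurve Literature.NumberTheory.EllipticCurves
  Literature.NumberTheory.EllipticCurves.ModularForms
  Literature.NumberTheory.EllipticCurves.Rank1Residual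
  Literature.NumberTheory.EllipticCurves.Rank1Residual.Typed
  Literature.NumberTheory.EllipticCurves.Skinner2016
  Literature.NumberTheory.EllipticCurves.SteinWuthrich2013
  Literature.NumberTheory.EllipticCurves.Wuthrich2014

namespace Summit.BirchSwinnertonDyer.BirchSwinnertonDyer.Theorems.ExceptionalZeroRoad

open Summit.BirchSwinnertonDyer.Rank1Residual Summit.BirchSwinnertonDyer.Rank1Residual.X11b

/-! ### §1 Valuation algebra: when the cofactor of Kato's divisibility is a unit -/

/-- **A cofactor with the lower-bound valuation identity is a unit.** In `ℚ_p`: if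
`h(0)·u·#S·M = u'·s·M` with `M ≠ 0`, `u, u' ∈ ℤ_pˣ`, `#S ≥ 1` a natural number (`#Ш[p^∞]`),
`s ∈ ℚ^×` (`#Ш_an`) and `ord_p s ≤ ord_p #S` (the LOWER half of `BSD(E,p)`), then `h(0) ∈ ℤ_pˣ`,
i.e. `h ∈ Λˣ` (`PowerSeries.isUnit_iff_constantCoeff`): `ord_p h(0) = ord_p s - ord_p #S ≤ 0`
and `h(0) ∈ ℤ_p`. The rank-one analogue of the closing step of x11a's
`mazurMainConjectureAt_of_padicValRat_le` (Greenberg, LNM 1716 §4–5). [folklore] -/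
theorem isUnit_of_cofactor_identity {p : ℕ} [Fact p.Prime] (h : IwasawaAlgebra p) (u u' : ℤ_[p]ˣ)
    {S : ℕ} (hS : S ≠ 0) {s : ℚ} (hs : s ≠ 0) {M : ℚ_[p]} (hM : M ≠ 0)
    (key : ((PowerSeries.constantCoeff h : ℤ_[p]) : ℚ_[p]) * ((u : ℤ_[p]) : ℚ_[p]) * (S : ℚ_[p]) * M =
      ((u' : ℤ_[p]) : ℚ_[p]) * (s : ℚ_[p]) * M)
    (hle : padicValRat p s ≤ padicValNat p S) : IsUnit h := by
  set h0 : ℚ_[p] := ((PowerSeries.constantCoeff h : ℤ_[p]) : ℚ_[p]) with hh0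
  have hSp : (S : ℚ_[p]) ≠ 0 := by exact_mod_cast hS
  have hsp : (s : ℚ_[p]) ≠ 0 := by exact_mod_cast hs
  -- cancel `M`
  have key' : h0 * ((u : ℤ_[p]) : ℚ_[p]) * (S : ℚ_[p]) = ((u' : ℤ_[p]) : ℚ_[p]) * (s : ℚ_[p]) :=
    mul_right_cancel₀ hM key
  have hh0ne : h0 ≠ 0 := by
    intro h0'
    rw [h0', zero_mul, zero_mul] at key'
    exact (mul_ne_zero (coe_units_ne_zero p u') hsp) key'.symm
  have hh00 : PowerSeries.constantCoeff h ≠ 0 := by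
    intro h0'
    exact hh0ne (by rw [hh0, h0', PadicInt.coe_zero])
  have hh0val : 0 ≤ h0.valuation := by
    rw [hh0]
    exact PadicInt.valuation_coe_nonneg
  have hval := congrArg Padic.valuation key'
  rw [Padic.valuation_mul (mul_ne_zero hh0ne (coe_units_ne_zero p u)) hSp,
    Padic.valuation_mul hh0ne (coe_units_ne_zero p u), valuation_coe_units_eq_zero,
    Padic.valuation_mul (coe_units_ne_zero p u') hsp, valuation_coe_units_eq_zero,
    Padic.valuation_ratCast, Padic.valuation_natCast] at hval
  have hh0zero : h0.valuation = 0 := by linarith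
  have hvalh : (PowerSeries.constantCoeff h : ℤ_[p]).valuation = 0 := by
    have h' : (((PowerSeries.constantCoeff h : ℤ_[p]) : ℚ_[p])).valuation = 0 := by
      rw [← hh0]; exact hh0zero
    rw [PadicInt.valuation_coe] at h'
    exact_mod_cast h'
  have hunit0 : IsUnit (PowerSeries.constantCoeff h : ℤ_[p]) := by
    rw [PadicInt.isUnit_iff, PadicInt.norm_eq_zpow_neg_valuation hh00, hvalh]
    simp
  exact PowerSeries.isUnit_iff_constantCoeff.mpr hunit0

/-! ### §2 Datum level: the cofactor is a unit, split and non-split shapes -/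

section Datum

variable {W : WeierstrassCurve ℚ} [W.IsElliptic] [W.IsGloballyMinimal] {p : ℕ} [Fact p.Prime]
  {κ : ZpExtension ℚ p} {γ : Field.absoluteGaloisGroup ℚ}

/-- **SPLIT multiplicative `p ≠ 2`, analytic rank one: the cofactor of Kato's divisibility is a
unit, from the exceptional relative display, Schneider at the datum and the lower half of
`BSD(E,p)`.** Data: the cyclotomic pair `(κ, γ)`, `X(E/ℚ_∞)` torsion with `char = (g)`, Kato's
shape `ι(T·g·h) = c·L` with an ARBITRARY cofactor `h ∈ Λ`, THE split-canonical §4.2 height `Dh`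
with `Reg_p(Dh) ≠ 0`, and `s ∈ ℚ^×` with the relative display
`c·[T²]L·(log_p γ_cyc)²·#E(ℚ)_tors² = u'·𝓛_p·(s·Reg_p(Dh)·∏c_v)` and `ord_p s ≤ ord_p #Ш[p^∞]`.
Then `h ∈ Λˣ`. Proof: Jones (SW Thm. 6.1 split): `ord_T g ≥ 1` and
`[T¹]g·(log_p γ)²·#T² = u·𝓛_p·#Ш[p^∞]·Reg_p·∏c_v`; `c·[T²]L = [T¹]g·h(0)`; cancel
`𝓛_p·Reg_p·∏c_v ≠ 0` (`LInvariant_ne_zero_holds`) and apply `isUnit_of_cofactor_identity`.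
CONDITIONAL on `hJ`, `hGZK`. [cite: SteinWuthrich2013, Thm. 6.1 (p. 20) and §4.2]
[cite: Wuthrich2014, Cor. 19 proof, first case (p. 399)] [cite: Miller2011LMS, Def. 1.1] -/
theorem isUnit_cofactor_of_relativeLeadingTerm_split (hJ : thm61_splitMultiplicative)
    (hGZK : rank_eq_analyticRank_of_analyticRank_le_one) (hp : p ≠ 2) (hr : W.analyticRank = 1)
    (Dq : TateParameterData W p)
    (hκ : κ.IsCyclotomic) (hγ : κ.IsTopGenerator γ) (hγ' : IsCyclotomicVariable p γ)
    (D : W.SelmerDualData κ γ) (hX : D.IsTorsion) {g : IwasawaAlgebra p}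
    (hchar : D.charIdeal = Ideal.span {g}) (h : IwasawaAlgebra p) {c : ℚ_[p]}
    {L : PowerSeries ℚ_[p]}
    (hw : iwasawaToPowerSeries p ((PowerSeries.X : IwasawaAlgebra p) * g * h) = PowerSeries.C c * L)
    (Dh : PAdicHeightData W p) (hDh : IsSplitMultCanonical Dh Dq) (hSch : SchneiderConjecture Dh)
    {s : ℚ} (hs0 : s ≠ 0) (u' : ℤ_[p]ˣ)
    (hDis : c * PowerSeries.coeff 2 L * padicLog p (cyclotomicGenerator p) ^ 2 *
        (W.torsionOrder : ℚ_[p]) ^ 2 =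
      ((u' : ℤ_[p]) : ℚ_[p]) * (LInvariant Dq * ((s : ℚ_[p]) * padicRegulator Dh * W.tamagawaProduct)))
    (hle : padicValRat p s ≤ padicValNat p (Nat.card (AddCommGroup.primaryComponent W.sha p))) :
    IsUnit h := by
  haveI : Module.Finite (IwasawaAlgebra p) D.X := D.module_finite_holds hγ
  obtain ⟨hrank, hfin⟩ := hGZK W (by omega)
  have hr1 : W.mordellWeilRank = 1 := by rw [hrank, hr]
  haveI : Finite W.sha := hfin
  haveI hfinp : Finite (AddCommGroup.primaryComponent W.sha p) := inferInstance
  -- Jones: `ord_T g ≥ 1` and the leading term at order `1` (split shape)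
  obtain ⟨hle1, -, h3⟩ := hJ W p hp Dq κ γ hκ hγ hγ' D hX g hchar Dh hDh
  obtain ⟨u, hu⟩ := h3 hSch hfinp
  rw [hr1] at hle1 hu
  -- `c · [T²]L = g₁ · h(0)`
  have hι : c * PowerSeries.coeff 2 L =
      ((PowerSeries.coeff 1 g : ℤ_[p]) : ℚ_[p]) * ((PowerSeries.constantCoeff h : ℤ_[p]) : ℚ_[p]) := by
    have := coeff_eq_mul_constantCoeff_of_le_order h hle1 1 (c := c) (L := L) (by simpa using hw)
    simpa using this
  -- cancelled factor `M = 𝓛_p · Reg_p · ∏ c_v ≠ 0`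
  have h𝓛 : LInvariant Dq ≠ 0 := LInvariant_ne_zero_holds (W := W) (p := p) Dq
  have hReg : padicRegulator Dh ≠ 0 := hSch
  have hc0 : (W.tamagawaProduct : ℚ_[p]) ≠ 0 := by
    exact_mod_cast (W.tamagawaProduct_pos_holds : 0 < W.tamagawaProduct).ne'
  have hM : LInvariant Dq * padicRegulator Dh * (W.tamagawaProduct : ℚ_[p]) ≠ 0 :=
    mul_ne_zero (mul_ne_zero h𝓛 hReg) hc0
  have hS : Nat.card (AddCommGroup.primaryComponent W.sha p) ≠ 0 := Nat.card_pos.ne'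
  refine isUnit_of_cofactor_identity h u u' hS hs0 hM ?_ hle
  -- `h(0)·u·#S·M = u'·s·M`: multiply Jones's display by `h(0)` and compare with the analytic one
  linear_combination (-((PowerSeries.constantCoeff h : ℤ_[p]) : ℚ_[p])) * hu + hDis -
    (padicLog p (cyclotomicGenerator p) ^ 2 * (W.torsionOrder : ℚ_[p]) ^ 2) * hι

/-- **NON-SPLIT multiplicative `p ≠ 2`, analytic rank one: the cofactor of Kato's divisibility is
a unit**, as `isUnit_cofactor_of_relativeLeadingTerm_split` with the non-exceptional shapes:
Kato `ι(g·h) = c·L`, Jones `[T¹]g·log_p γ·#T² = u·2·#Ш[p^∞]·Reg_p·∏c_v` (SW Thm. 6.1 non-split,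
THE (4.1) height `IsMultCanonical Dh q`), the relative display
`c·[T¹]L·log_p γ·#T² = u'·2·(s·Reg_p·∏c_v)` (Disegni 2020 Thm. 4 first bullet, any odd `p`),
`Reg_p(Dh) ≠ 0` and `ord_p s ≤ ord_p #Ш[p^∞]`. CONDITIONAL on `hJ`, `hGZK`.
[cite: SteinWuthrich2013, Thm. 6.1 (p. 20) and §4.2] [cite: Disegni2020, Thm. 4 first bullet (§3.2)]
[cite: Wuthrich2014, Cor. 19 proof, first case (p. 399)] [cite: Miller2011LMS, Def. 1.1] -/
theorem isUnit_cofactor_of_relativeLeadingTerm_nonsplit (hJ : thm61_nonsplitMultiplicative)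
    (hGZK : rank_eq_analyticRank_of_analyticRank_le_one) (hp : p ≠ 2) (hr : W.analyticRank = 1)
    (hmult : W.HasMultiplicativeReductionAtPrime p) (hns : ¬ W.HasSplitMultiplicativeReductionAtPrime p)
    {q : ℚ_[p]} (hq0 : q ≠ 0) (hq1 : ‖q‖ < 1) (hqj : tateJ q = (W.j : ℚ_[p]))
    (hκ : κ.IsCyclotomic) (hγ : κ.IsTopGenerator γ) (hγ' : IsCyclotomicVariable p γ)
    (D : W.SelmerDualData κ γ) (hX : D.IsTorsion) {g : IwasawaAlgebra p}
    (hchar : D.charIdeal = Ideal.span {g}) (h : IwasawaAlgebra p) {c : ℚ_[p]}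
    {L : PowerSeries ℚ_[p]}
    (hw : iwasawaToPowerSeries p (g * h) = PowerSeries.C c * L)
    (Dh : PAdicHeightData W p) (hDh : IsMultCanonical Dh q) (hSch : SchneiderConjecture Dh)
    {s : ℚ} (hs0 : s ≠ 0) (u' : ℤ_[p]ˣ)
    (hDis : c * PowerSeries.coeff 1 L * padicLog p (cyclotomicGenerator p) *
        (W.torsionOrder : ℚ_[p]) ^ 2 =
      ((u' : ℤ_[p]) : ℚ_[p]) * (2 * ((s : ℚ_[p]) * padicRegulator Dh * W.tamagawaProduct)))
    (hle : padicValRat p s ≤ padicValNat p (Nat.card (AddCommGroup.primaryComponent W.sha p))) :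
    IsUnit h := by
  haveI : Module.Finite (IwasawaAlgebra p) D.X := D.module_finite_holds hγ
  obtain ⟨hrank, hfin⟩ := hGZK W (by omega)
  have hr1 : W.mordellWeilRank = 1 := by rw [hrank, hr]
  haveI : Finite W.sha := hfin
  haveI hfinp : Finite (AddCommGroup.primaryComponent W.sha p) := inferInstance
  -- Jones: `ord_T g ≥ 1` and the leading term at order `1` (non-split shape)
  obtain ⟨hle1, -, h3⟩ := hJ W p hp hmult hns q hq0 hq1 hqj κ γ hκ hγ hγ' D hX g hchar Dh hDh
  obtain ⟨u, hu⟩ := h3 hSch hfinp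
  rw [hr1] at hle1 hu
  simp only [pow_one] at hu
  -- `c · [T¹]L = g₁ · h(0)`
  have hι : c * PowerSeries.coeff 1 L =
      ((PowerSeries.coeff 1 g : ℤ_[p]) : ℚ_[p]) * ((PowerSeries.constantCoeff h : ℤ_[p]) : ℚ_[p]) := by
    have := coeff_eq_mul_constantCoeff_of_le_order h hle1 0 (c := c) (L := L) (by simpa using hw)
    simpa using this
  -- cancelled factor `M = 2 · Reg_p · ∏ c_v ≠ 0`
  have hReg : padicRegulator Dh ≠ 0 := hSch
  have hc0 : (W.tamagawaProduct : ℚ_[p]) ≠ 0 := by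
    exact_mod_cast (W.tamagawaProduct_pos_holds : 0 < W.tamagawaProduct).ne'
  have hM : (2 : ℚ_[p]) * padicRegulator Dh * (W.tamagawaProduct : ℚ_[p]) ≠ 0 :=
    mul_ne_zero (mul_ne_zero two_ne_zero hReg) hc0
  have hS : Nat.card (AddCommGroup.primaryComponent W.sha p) ≠ 0 := Nat.card_pos.ne'
  refine isUnit_of_cofactor_identity h u u' hS hs0 hM ?_ hle
  linear_combination (-((PowerSeries.constantCoeff h : ℤ_[p]) : ℚ_[p])) * hu + hDis -
    (padicLog p (cyclotomicGenerator p) * (W.torsionOrder : ℚ_[p]) ^ 2) * hι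

end Datum

/-! ### §3 Class level: Mazur's main conjecture at the pair FROM the lower half of `BSD(E,p)` -/

section Class

variable (W : WeierstrassCurve ℚ) [W.IsElliptic] [W.IsGloballyMinimal] (p : ℕ) [Fact p.Prime]

omit [W.IsGloballyMinimal] in
/-- `#Ш_an` bookkeeping in analytic rank one: the rational `s` of the LOWER half
(`Typed.MissingLowerBoundAt`: `#Ш_an = s`, `ord_p s ≤ ord_p #Ш`) is non-zero (Gross–Zagier, `hGZ`)
and satisfies `ord_p s ≤ ord_p #Ш[p^∞]` (finite `Ш`, GZK). [cite: GrossZagier1986, Thm. I.(7.3) 2)]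
[cite: Miller2011LMS, Def. 1.1] -/
theorem exists_shaAn_padicValRat_le_card_primaryComponent (hGZ : GrossZagier1986_thm_I_7_3)
    (hGZK : rank_eq_analyticRank_of_analyticRank_le_one) (hr : W.analyticRank = 1)
    (hlow : Typed.MissingLowerBoundAt W p) :
    ∃ s : ℚ, s ≠ 0 ∧ shaAn W = (s : ℂ) ∧
      padicValRat p s ≤ padicValNat p (Nat.card (AddCommGroup.primaryComponent W.sha p)) := by
  haveI : Finite W.sha := (hGZK W (by omega)).2
  obtain ⟨s, hs, hle⟩ := hlow
  obtain ⟨s', hs'0, hs'⟩ := exists_rat_ne_zero_shaAn_eq_of_analyticRank_eq_one hGZ hGZK W hr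
  have hss' : s = s' := by
    have : ((s : ℚ) : ℂ) = ((s' : ℚ) : ℂ) := hs.symm.trans hs'
    exact_mod_cast this
  refine ⟨s, hss' ▸ hs'0, hs, ?_⟩
  rwa [WeierstrassCurve.shaOrder, ← padicValNat_card_addPrimaryComponent (A := W.sha) p] at hle

/-- **SPLIT multiplicative odd `p`, analytic rank one, `ρ̄_{E,p^n}` onto for every `n`: the LOWER
half of `BSD(E,p)` + the exceptional relative display + Schneider ⟹ Mazur's main conjecture at
`(E,p)`.** Hypotheses: the PUBLISHED named facts Kato (`hKato`), SW Thm. 6.1 split (`hJs`) + §4.2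
split-canonical height existence (`hHs`), Gross–Zagier I.(7.3) (`hGZ`), GZK (`hGZK`); the data
`p ≠ 2`, multiplicative and split at `p`, `ord_{s=1}L(E,s) = 1`, `ρ̄_{E,p^n}` onto (`hρ`; at
`p ≥ 5` from `ρ̄_{E,p}` onto by Serre); the lane's CONJECTURE `RelativeExceptionalLeadingTermAt W p`
(`hC` — Disegni 2020 Thm. 1 split clause for `p ≥ 5` with a second multiplicative prime; beyond
print otherwise); Schneider for THE split-canonical datum (`hSch`); and the lower half
`Typed.MissingLowerBoundAt W p`. Conclusion `X2.MazurMainConjectureAt W p`: at every datum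
`(κ, γ, f, ϖ, D)`, `X` torsion, `char = (f_E)`, `ι(T·f_E·h) = ϖ·L_p` with `h ∈ Λˣ` (the non-split
clause being vacuous). Proof: Kato gives the divisibility with SOME cofactor `h`; the display for
THIS `(f, ϖ, L, Dh)` and `isUnit_cofactor_of_relativeLeadingTerm_split` make `h` a unit. No (ram),
no `μ`, no `p ≥ 5`. CONDITIONAL on the named facts and on the UNPROVED conjecture; nothing booked.
[cite: Wuthrich2014, Thm. 3 (p. 383) and Cor. 19 proof, first case (p. 399)]
[cite: SteinWuthrich2013, Thm. 6.1 (p. 20) and §4.2] [cite: GrossZagier1986, Thm. I.(7.3) 2)]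
[cite: Skinner2016PacificMC, Thm. A with §3.3 (shape only)] [cite: Miller2011LMS, Def. 1.1]
[cite: MazurTateTeitelbaum1986Invent, §II.10 (exceptional case)] -/
theorem mazurMainConjectureAt_of_missingLowerBoundAt_of_split
    (hKato : kato_charIdeal_dvd_multiplicative_of_surjective) (hJs : thm61_splitMultiplicative)
    (hHs : exists_isSplitMultCanonical) (hGZ : GrossZagier1986_thm_I_7_3)
    (hGZK : rank_eq_analyticRank_of_analyticRank_le_one)
    (hp2 : p ≠ 2) (hmult : W.HasMultiplicativeReductionAtPrime p)
    (hsplit : W.HasSplitMultiplicativeReductionAtPrime p) (hr : W.analyticRank = 1)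
    (hρ : ∀ n : ℕ, W.HasSurjectiveModNGaloisRep (p ^ n : ℕ))
    (hC : ClassClosure.RelativeExceptionalLeadingTermAt W p)
    (hSch : ∀ (Dq : TateParameterData W p) (Dh : PAdicHeightData W p),
      IsSplitMultCanonical Dh Dq → SchneiderConjecture Dh)
    (hlow : Typed.MissingLowerBoundAt W p) : X2.MazurMainConjectureAt W p := by
  intro κ γ hκ hγ hγ' N _ f hf D ϖ hϖ
  haveI : Module.Finite (IwasawaAlgebra p) D.X := D.module_finite_holds hγ
  -- Kato's divisibility for this datum
  obtain ⟨hXt, -, hKs⟩ := hKato W p hp2 hmult hρ hκ hγ hγ' hf D ϖ hϖ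
  -- a generator `fE` of the (principal) characteristic ideal
  obtain ⟨fE, hfE⟩ := (charIdeal_isPrincipal_holds p D.X).principal
  have hchar : D.charIdeal = Ideal.span {fE} := hfE
  -- `ϖ ≠ 0` since `Ω⁺_f > 0`
  have hϖ0 : ϖ ≠ 0 := by
    rintro rfl
    have hper : 0 < plusPeriod f := IsNewform0.plusPeriod_pos_holds hf.1 hf.coeffField_eq_bot
    rw [← hϖ, Rat.cast_zero, zero_mul] at hper
    exact lt_irrefl _ hper
  -- `#Ш_an = s ≠ 0` with the lower-bound valuation clause
  obtain ⟨s, hs0, hs, hle⟩ :=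
    exists_shaAn_padicValRat_le_card_primaryComponent W p hGZ hGZK hr hlow
  refine ⟨hXt, fE, hchar, fun _ L hL => ?_, fun hns _ _ => absurd hsplit hns⟩
  obtain ⟨g, hgmem, hιg⟩ := hKs hsplit L hL
  have hgmem' : g ∈ Ideal.span {fE} := by rw [← hchar]; exact hgmem
  obtain ⟨h, hgh⟩ := Ideal.mem_span_singleton'.mp hgmem'
  -- data: Tate parameter, THE split-canonical §4.2 height
  obtain ⟨Dq⟩ := (nonempty_tateParameterData_iff_holds (W := W) (p := p)).mpr hsplit
  obtain ⟨Dh, hDh⟩ := hHs W p hp2 Dq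
  -- the relative exceptional display AT THIS DATUM, from the conjecture
  obtain ⟨s', u', hs', hDis⟩ := hC hp2 hsplit hr hf ϖ hϖ0 hϖ Dq L hL Dh hDh
  have hss' : s' = s := by
    have : ((s' : ℚ) : ℂ) = ((s : ℚ) : ℂ) := hs'.symm.trans hs
    exact_mod_cast this
  subst hss'
  have hw : iwasawaToPowerSeries p ((PowerSeries.X : IwasawaAlgebra p) * fE * h) =
      PowerSeries.C ((ϖ : ℚ) : ℚ_[p]) * L := by
    rw [show (PowerSeries.X : IwasawaAlgebra p) * fE * h = PowerSeries.X * g by rw [← hgh]; ring]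
    exact hιg
  have hunit : IsUnit h :=
    isUnit_cofactor_of_relativeLeadingTerm_split hJs hGZK hp2 hr Dq hκ hγ hγ' D hXt hchar h hw Dh hDh
      (hSch Dq Dh hDh) hs0 u' hDis hle
  refine ⟨hunit.unit, ?_⟩
  rw [IsUnit.unit_spec]
  exact hw

/-- **NON-SPLIT multiplicative odd `p`, analytic rank one, `ρ̄_{E,p^n}` onto for every `n`: the
LOWER half of `BSD(E,p)` + Disegni's non-split clause at the pair + Schneider ⟹ Mazur's main
conjecture at `(E,p)`.** As `mazurMainConjectureAt_of_missingLowerBoundAt_of_split`, with SW Thm.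
6.1 non-split (`hJn`), THE (4.1) height (`hHn`), and — in place of the conjecture — Disegni 2020
Thm. 4 first bullet AT THE PAIR (`hD`, inline, the binder shape of
`ClassClosure.bsdp_of_mazurMainConjectureAt_of_nonsplit_of_schneider`; PUBLISHED at every odd `p`,
`Disegni2020.thm1_padicBSD_rankOne_multiplicative.nonsplit`). All inputs PUBLISHED except the
pair's Schneider certificate (`hSch`, REG-MULT) and the image certificate `hρ`. CONDITIONAL;
nothing booked. [cite: Wuthrich2014, Thm. 3 (p. 383) and Cor. 19 proof, first case (p. 399)]
[cite: SteinWuthrich2013, Thm. 6.1 (p. 20) and §4.2] [cite: Disegni2020, Thm. 4 first bullet (§3.2)]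
[cite: GrossZagier1986, Thm. I.(7.3) 2)] [cite: Skinner2016PacificMC, Thm. A (shape only)]
[cite: Miller2011LMS, Def. 1.1] -/
theorem mazurMainConjectureAt_of_missingLowerBoundAt_of_nonsplit
    (hKato : kato_charIdeal_dvd_multiplicative_of_surjective) (hJn : thm61_nonsplitMultiplicative)
    (hHn : exists_isMultCanonical) (hGZ : GrossZagier1986_thm_I_7_3)
    (hGZK : rank_eq_analyticRank_of_analyticRank_le_one)
    (hD : ∀ {N : ℕ} [NeZero N] {f : CuspForm (Gamma0 N) 2}, IsNewformOf W f →
      ∀ (ϖ : ℚ), ϖ ≠ 0 → (ϖ : ℝ) * W.realPeriodRat = plusPeriod f →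
      ∀ (q : ℚ_[p]), q ≠ 0 → ‖q‖ < 1 → tateJ q = (W.j : ℚ_[p]) →
      ∀ (L : PowerSeries ℚ_[p]), IsMultPAdicLFunctionOf f p (-1) L →
      ∀ (Dh : PAdicHeightData W p), IsMultCanonical Dh q →
        ∃ (s : ℚ) (u : ℤ_[p]ˣ), shaAn W = (s : ℂ) ∧
          ((ϖ : ℚ) : ℚ_[p]) * PowerSeries.coeff 1 L * padicLog p (cyclotomicGenerator p) *
              (W.torsionOrder : ℚ_[p]) ^ 2 =
            ((u : ℤ_[p]) : ℚ_[p]) * (2 * ((s : ℚ_[p]) * padicRegulator Dh * W.tamagawaProduct)))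
    (hp2 : p ≠ 2) (hmult : W.HasMultiplicativeReductionAtPrime p)
    (hns : ¬ W.HasSplitMultiplicativeReductionAtPrime p) (hr : W.analyticRank = 1)
    (hρ : ∀ n : ℕ, W.HasSurjectiveModNGaloisRep (p ^ n : ℕ))
    (hSch : ∀ (q : ℚ_[p]) (Dh : PAdicHeightData W p), q ≠ 0 → ‖q‖ < 1 → tateJ q = (W.j : ℚ_[p]) →
      IsMultCanonical Dh q → SchneiderConjecture Dh)
    (hlow : Typed.MissingLowerBoundAt W p) : X2.MazurMainConjectureAt W p := by
  intro κ γ hκ hγ hγ' N _ f hf D ϖ hϖ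
  haveI : Module.Finite (IwasawaAlgebra p) D.X := D.module_finite_holds hγ
  obtain ⟨hXt, hKns, -⟩ := hKato W p hp2 hmult hρ hκ hγ hγ' hf D ϖ hϖ
  obtain ⟨fE, hfE⟩ := (charIdeal_isPrincipal_holds p D.X).principal
  have hchar : D.charIdeal = Ideal.span {fE} := hfE
  have hϖ0 : ϖ ≠ 0 := by
    rintro rfl
    have hper : 0 < plusPeriod f := IsNewform0.plusPeriod_pos_holds hf.1 hf.coeffField_eq_bot
    rw [← hϖ, Rat.cast_zero, zero_mul] at hper
    exact lt_irrefl _ hper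
  obtain ⟨s, hs0, hs, hle⟩ :=
    exists_shaAn_padicValRat_le_card_primaryComponent W p hGZ hGZK hr hlow
  refine ⟨hXt, fE, hchar, fun hsplit _ _ => absurd hsplit hns, fun _ L hL => ?_⟩
  obtain ⟨g, hgmem, hιg⟩ := hKns hns L hL
  have hgmem' : g ∈ Ideal.span {fE} := by rw [← hchar]; exact hgmem
  obtain ⟨h, hgh⟩ := Ideal.mem_span_singleton'.mp hgmem'
  -- data: the Tate parameter, THE (4.1) height
  obtain ⟨q, ⟨hq0, hq1, hqj⟩, -⟩ := existsUnique_tateJ_eq_of_one_lt_norm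
    (one_lt_norm_j_of_hasMultiplicativeReductionAtPrime (W := W) (p := p) hmult)
  obtain ⟨Dh, hDh⟩ := hHn W p hp2 hmult hns q hq0 hq1 hqj
  -- Disegni's non-split display AT THIS DATUM
  obtain ⟨s', u', hs', hDis⟩ := hD hf ϖ hϖ0 hϖ q hq0 hq1 hqj L hL Dh hDh
  have hss' : s' = s := by
    have : ((s' : ℚ) : ℂ) = ((s : ℚ) : ℂ) := hs'.symm.trans hs
    exact_mod_cast this
  subst hss'
  have hw : iwasawaToPowerSeries p (fE * h) = PowerSeries.C ((ϖ : ℚ) : ℚ_[p]) * L := by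
    rw [show fE * h = g by rw [← hgh]; ring]
    exact hιg
  have hunit : IsUnit h :=
    isUnit_cofactor_of_relativeLeadingTerm_nonsplit hJn hGZK hp2 hr hmult hns hq0 hq1 hqj hκ hγ hγ'
      D hXt hchar h hw Dh hDh (hSch q Dh hq0 hq1 hqj hDh) hs0 u' hDis hle
  refine ⟨hunit.unit, ?_⟩
  rw [IsUnit.unit_spec]
  exact hw

end Class

end Summit.BirchSwinnertonDyer.BirchSwinnertonDyer.Theorems.ExceptionalZeroRoad

end
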